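import Summits.QuantumFields.YangMills.Theorems.BalabanLadderIRTwistedSlabHessian
import Summits.QuantumFields.YangMills.Theorems.BalabanLadderIRTwistedSlabVacuumOrbits
import HarnessLib

/-!
# K3 in T1's own currency: the exponent of `wilsonFinTorusTensorTwistedPartition` (defining representation of `SU(N)`, magnetic slab
# twist `slabTwist (ω^k·1) 1`) along `t ↦ e^{ta}·ladder` is `lineAction`, and its Hessian at every decorated twist-eating ladder of
# `…TwistedSlabVacuumOrbits` has the Coulomb-gauge gap `4 sin²(π/(Nℓ₀))`, uniformly in `L, T`

HELPER toward stub **T1** `TwistedSlabAnchor` (LINE `twisted-slab-continuity`, crux `IRcof` stmt-QuantumFields-26930, census row 43;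
LEAD prover ym-ir-line-tsc-p1 g3; `--supports` the crux, `--as helper`).  Fifth (closing) file of the HOME HANDOFF item K3.
* §1 coercion dictionary `SU(N) → M_N(ℂ)`: `coe_finTorusPlaquette_eq_bgPlaq` (the group plaquette, coerced, is
  `bgPlaq` of the coerced links), `coe_tHooftTwistTensor_slabTwist` (the magnetic slab tensor acts by the phases `slabTwistPhase k`),
  `coe_ladderConfig_pair` (the decorated ladder `ladderConfig ![A, B, ω^i·1, ω^j·1]`, coerced, is `ladderField ![A, B, ω^i•1, ω^j•1]`).
* §2 ★ `twistedAction_along_eq_lineAction`: for ANY family of `SU(N)` configurations `V t` with `↑(V t e) = e^{t a_e} · ↑(U₀ e)` the exponent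
  `Σ_x Σ_{μ<ν} (N − Re tr ρ_fund(w_x · P_{V t}(x)))` of `wilsonFinTorusTensorTwistedPartition (fundamentalRep (Fin N)) β (slabTwist (ω^k·1) 1)`
  IS `lineAction (↑U₀) a (slabTwistPhase k) t` of `…TwistedSlabHessian` (no statement about `exp` landing in `SU(N)` is needed or made).
* §3 ★ `ladder_eats_slabTwistPhase`: the decorated ladders EAT the slab phases (`bgPlaq = conj(c)·1`; from K2's `ladder_pair_twistedFlat` BY NAME);
  ★★★ `twistedAction_hessian_gap_ladder_specialUnitary`: `SU(N)`, `k` a unit, reference pair `B A B⁻¹ A⁻¹ = ω^k·1`, labels `i, j`, ANY box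
  `(m+1) × (m+1) × (m₂+1) × (m₃+1)`, any such family `V t` through `ladderConfig ![A, B, ω^i·1, ω^j·1]`, any traceless skew-Hermitian `a` on
  the Coulomb slice of the ladder: `4 sin²(π/(N(m+1))) · Σ_x Σ_μ S(a_μ x) ≤ d²/dt²|₀ Σ_x Σ_{μ<ν} (N − Re tr ρ_fund(w_x · P_{V t}(x)))`, together with
  `twistedAction_along_zero` (value `0` at `t = 0`: the K2 vacuum) and `deriv_twistedAction_along_zero` (critical).  This is the
  TRANSVERSAL MORSE–BOTT NON-DEGENERACY of the N² critical orbits `𝒢 • ladder(A, B, ω^i·1, ω^j·1)` of the e₂-projected slab weight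
  (`twistedAction_eq_zero_iff_exists_gaugeAct_ladder_specialUnitary`, p664129) along Coulomb-gauge lines, constant UNIFORM in the long
  extents — tree-level input `A(p)` of `tendsto_laplaceMethod_fibred` in the T1-tree-exact roadmap (T1-ANATOMY §9.3, brick 2 now IN T1's currency).
NOT done here (honest scope): general `r : LatticeRep SU(N)` (the quadratic form rescales by the Dynkin index of `r.ρ` — needs `dρ`), the
joint second-order expansion on `SU(N)^E` with remainder (M1), anything uniform in `β` (M3), the cluster expansion (M4).

HONEST FRAMING: tree-level statements on one box; T1-box 0∕1, T1 proper (uniform exponential vacuum dominance of the e₂-projected slab)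
0∕1; nothing here bears on `IRcof`, `IR`, or the Yang–Mills mass gap (Clay: NOT proved); R4 = `BalabanLadder.UV` only.  References:
M. García Pérez, A. González-Arroyo, M. Okawa, JHEP 10 (2017) 150 §2.2–§2.5; IJMPA 29 (2014) 1445001 §3; 't Hooft, NPB 153 (1979) §3.
-/

set_option autoImplicit false

noncomputable section

open scoped Matrix
open Finset NormedSpace
open Literature.MathematicalPhysics.QuantumFieldTheory Literature.MathematicalPhysics.QuantumLattice
open Literature.MathematicalPhysics.QuantumLattice.WilsonSecondVariation

namespace Summit.QuantumFields.YangMills.Cruxes.IRcof.TwistedSlab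

variable {N : ℕ} {n₀ n₁ n₂ n₃ : ℕ}

/-! ## §1 Coercion dictionary `SU(N) → M_N(ℂ)` -/

section Coe

/-- In `SU(N)` the inverse is the adjoint: `↑(g⁻¹) = (↑g)ᴴ` (`rfl`; also landed as `su_coe_inv` in the Dobrushin chain, kept private here
to avoid that import). [folklore] -/
private theorem coe_inv_eq_conjTranspose (g : Matrix.specialUnitaryGroup (Fin N) ℂ) :
    ((g⁻¹ : Matrix.specialUnitaryGroup (Fin N) ℂ) : Matrix (Fin N) (Fin N) ℂ) = (g : Matrix (Fin N) (Fin N) ℂ)ᴴ := rfl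

/-- **The group plaquette, coerced, is the matrix plaquette `bgPlaq` of the coerced links.** [cite: Wilson1974] -/
theorem coe_finTorusPlaquette_eq_bgPlaq (V : FinTorusSite n₀ n₁ n₂ n₃ × Fin 4 → Matrix.specialUnitaryGroup (Fin N) ℂ)
    (x : FinTorusSite n₀ n₁ n₂ n₃) (μ ν : Fin 4) :
    ((finTorusPlaquette V x μ ν : Matrix.specialUnitaryGroup (Fin N) ℂ) : Matrix (Fin N) (Fin N) ℂ) =
      bgPlaq (fun e => (V e : Matrix (Fin N) (Fin N) ℂ)) x μ ν := by
  simp only [finTorusPlaquette, bgPlaq, Submonoid.coe_mul, coe_inv_eq_conjTranspose]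

/-- The plaquette phases of the magnetic slab tensor `slabTwist (ω^k·1) 1`: `ω^k` on the stack `x₀ = x₁ = 0` of `(0,1)`-plaquettes, `1`
elsewhere. [cite: tHooft1979Flux, §2 (2.5)–(2.6)] -/
def slabTwistPhase (k : ZMod N) (x : FinTorusSite n₀ n₁ n₂ n₃) (μ ν : Fin 4) : ℂ :=
  if finTorusSiteCoord x μ = 0 ∧ finTorusSiteCoord x ν = 0 then (if μ = 0 ∧ ν = 1 then centerPhase N k else 1) else 1

/-- The slab phases have modulus one. [folklore] -/
theorem star_slabTwistPhase_mul_self (k : ZMod N) (x : FinTorusSite n₀ n₁ n₂ n₃) (μ ν : Fin 4) :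
    star (slabTwistPhase k x μ ν) * slabTwistPhase k x μ ν = 1 := by
  unfold slabTwistPhase
  split_ifs
  · rw [Complex.star_def, Complex.conj_mul', norm_centerPhase]; simp
  · simp
  · simp

/-- `star (ω^i) * ω^i = 1` for the centre phases. [folklore] -/
theorem star_centerPhase_mul_self (i : ZMod N) : star (centerPhase N i) * centerPhase N i = 1 := by
  rw [Complex.star_def, Complex.conj_mul', norm_centerPhase]; simp

/-- **The magnetic slab tensor acts by its phases**: `↑(tHooftTwistTensor (slabTwist (ω^k·1) 1) x μ ν) = slabTwistPhase k x μ ν • 1`.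
[cite: tHooft1979Flux, §2 (2.5)–(2.6)] -/
theorem coe_tHooftTwistTensor_slabTwist (k : ZMod N) (x : FinTorusSite n₀ n₁ n₂ n₃) (μ ν : Fin 4) :
    ((tHooftTwistTensor (slabTwist (suCenter N k : Matrix.specialUnitaryGroup (Fin N) ℂ) 1) x μ ν :
        Matrix.specialUnitaryGroup (Fin N) ℂ) : Matrix (Fin N) (Fin N) ℂ) = slabTwistPhase k x μ ν • (1 : Matrix (Fin N) (Fin N) ℂ) := by
  unfold tHooftTwistTensor slabTwist slabTwistPhase
  by_cases hx : finTorusSiteCoord x μ = 0 ∧ finTorusSiteCoord x ν = 0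
  · simp only [if_pos hx]
    by_cases h01 : μ = 0 ∧ ν = 1
    · simp only [if_pos h01, coe_suCenter]
    · simp only [if_neg h01]
      split_ifs <;> simp
  · simp only [if_neg hx]; simp

/-- **The decorated twist-eating ladder of `…TwistedSlabVacuumOrbits`, coerced, is the matrix ladder `ladderField ![A, B, ω^i•1, ω^j•1]`.**
[folklore] -/
theorem coe_ladderConfig_pair (A B : Matrix.specialUnitaryGroup (Fin N) ℂ) (i j : ZMod N) :
    (fun e : FinTorusSite n₀ n₁ n₂ n₃ × Fin 4 => ((ladderConfig ![A, B, (suCenter N i : Matrix.specialUnitaryGroup (Fin N) ℂ),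
        (suCenter N j : Matrix.specialUnitaryGroup (Fin N) ℂ)] e : Matrix.specialUnitaryGroup (Fin N) ℂ) : Matrix (Fin N) (Fin N) ℂ)) =
      ladderField ![(A : Matrix (Fin N) (Fin N) ℂ), (B : Matrix (Fin N) (Fin N) ℂ), centerPhase N i • (1 : Matrix (Fin N) (Fin N) ℂ),
        centerPhase N j • (1 : Matrix (Fin N) (Fin N) ℂ)] := by
  have hΓ : (fun μ => ((![A, B, (suCenter N i : Matrix.specialUnitaryGroup (Fin N) ℂ),
        (suCenter N j : Matrix.specialUnitaryGroup (Fin N) ℂ)] μ : Matrix.specialUnitaryGroup (Fin N) ℂ) : Matrix (Fin N) (Fin N) ℂ)) =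
      ![(A : Matrix (Fin N) (Fin N) ℂ), (B : Matrix (Fin N) (Fin N) ℂ), centerPhase N i • (1 : Matrix (Fin N) (Fin N) ℂ),
        centerPhase N j • (1 : Matrix (Fin N) (Fin N) ℂ)] := by
    funext μ; fin_cases μ <;> simp [coe_suCenter]
  rw [← hΓ, ladderField_eq_coe_ladderConfig]

end Coe

/-! ## §2 The T1 exponent along the line is `lineAction` -/

section Along

/-- ★ **The exponent of `wilsonFinTorusTensorTwistedPartition (fundamentalRep (Fin N)) β (slabTwist (ω^k·1) 1)` along `t ↦ e^{ta}·U₀` IS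
`lineAction (↑U₀) a (slabTwistPhase k) t`** — for ANY family of `SU(N)` configurations `V t` with `↑(V t (x,μ)) = e^{t a_μ(x)} · ↑(U₀ (x,μ))`.
[cite: tHooft1979Flux, §2 (2.6)] [cite: GarciaperezGonzalezarroyoOkawa2017, §2.3 (2.3)] -/
theorem twistedAction_along_eq_lineAction (k : ZMod N) (U₀ : FinTorusSite n₀ n₁ n₂ n₃ × Fin 4 → Matrix.specialUnitaryGroup (Fin N) ℂ)
    (a : Fin 4 → FinTorusSite n₀ n₁ n₂ n₃ → Matrix (Fin N) (Fin N) ℂ)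
    (V : ℝ → FinTorusSite n₀ n₁ n₂ n₃ × Fin 4 → Matrix.specialUnitaryGroup (Fin N) ℂ)
    (hV : ∀ (t : ℝ) (x : FinTorusSite n₀ n₁ n₂ n₃) (μ : Fin 4),
      ((V t (x, μ) : Matrix.specialUnitaryGroup (Fin N) ℂ) : Matrix (Fin N) (Fin N) ℂ) =
        exp (t • a μ x) * (U₀ (x, μ) : Matrix (Fin N) (Fin N) ℂ)) (t : ℝ) :
    (∑ x : FinTorusSite n₀ n₁ n₂ n₃, ∑ q : {q : Fin 4 × Fin 4 // q.1 < q.2},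
        ((N : ℝ) - (fundamentalRep (Fin N) (tHooftTwistTensor (slabTwist (suCenter N k : Matrix.specialUnitaryGroup (Fin N) ℂ) 1)
          x q.1.1 q.1.2 * finTorusPlaquette (V t) x q.1.1 q.1.2)).trace.re)) =
      lineAction (fun e => (U₀ e : Matrix (Fin N) (Fin N) ℂ)) a (slabTwistPhase k) t := by
  refine Finset.sum_congr rfl fun x _ => Finset.sum_congr rfl fun q _ => ?_
  rw [fundamentalRep_apply, Submonoid.coe_mul, coe_tHooftTwistTensor_slabTwist, coe_finTorusPlaquette_eq_bgPlaq, Matrix.smul_mul,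
    Matrix.one_mul]
  simp only [bgPlaq, hV, linePlaq, plaqHol, Matrix.conjTranspose_mul]

end Along

/-! ## §3 The Hessian gap at the decorated twist-eating ladders, in T1's currency -/

section LadderSU

variable {m m₂ m₃ : ℕ}

/-- ★ **The decorated twist-eating ladders EAT the slab phases**: `bgPlaq(ladder) = conj(slabTwistPhase) · 1` on every plaquette (K2's
`ladder_pair_twistedFlat` BY NAME, coerced). [cite: Gonzalezarroyo1998, §4.2] -/
theorem ladder_eats_slabTwistPhase {k : ZMod N} {A B : Matrix.specialUnitaryGroup (Fin N) ℂ}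
    (hAB : B * A * B⁻¹ * A⁻¹ = (suCenter N k : Matrix.specialUnitaryGroup (Fin N) ℂ)) (i j : ZMod N)
    (x : FinTorusSite (m + 1) (m + 1) (m₂ + 1) (m₃ + 1)) (μ ν : Fin 4) (hμν : μ < ν) :
    bgPlaq (ladderField ![(A : Matrix (Fin N) (Fin N) ℂ), (B : Matrix (Fin N) (Fin N) ℂ), centerPhase N i • (1 : Matrix (Fin N) (Fin N) ℂ),
        centerPhase N j • (1 : Matrix (Fin N) (Fin N) ℂ)]) x μ ν =
      star (slabTwistPhase k x μ ν) • (1 : Matrix (Fin N) (Fin N) ℂ) := by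
  have h := ladder_pair_twistedFlat (m₀ := m) (m₁ := m) (m₂ := m₂) (m₃ := m₃) (suCenter N k).2 hAB (suCenter N i).2 (suCenter N j).2 x hμν
  have hc := congrArg (fun g : Matrix.specialUnitaryGroup (Fin N) ℂ => (g : Matrix (Fin N) (Fin N) ℂ)) h
  simp only [Submonoid.coe_mul, coe_tHooftTwistTensor_slabTwist, coe_finTorusPlaquette_eq_bgPlaq, OneMemClass.coe_one, Matrix.smul_mul,
    Matrix.one_mul] at hc
  rw [← coe_ladderConfig_pair]
  -- `c • P = 1` with `|c| = 1` gives `P = conj(c) • 1`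
  have hcc := star_slabTwistPhase_mul_self k x μ ν
  calc bgPlaq (fun e => ((ladderConfig ![A, B, (suCenter N i : Matrix.specialUnitaryGroup (Fin N) ℂ),
          (suCenter N j : Matrix.specialUnitaryGroup (Fin N) ℂ)] e : Matrix.specialUnitaryGroup (Fin N) ℂ) : Matrix (Fin N) (Fin N) ℂ)) x μ ν
      = (star (slabTwistPhase k x μ ν) * slabTwistPhase k x μ ν) • bgPlaq (fun e => ((ladderConfig ![A, B,
          (suCenter N i : Matrix.specialUnitaryGroup (Fin N) ℂ), (suCenter N j : Matrix.specialUnitaryGroup (Fin N) ℂ)] e :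
            Matrix.specialUnitaryGroup (Fin N) ℂ) : Matrix (Fin N) (Fin N) ℂ)) x μ ν := by rw [hcc, one_smul]
    _ = star (slabTwistPhase k x μ ν) • (1 : Matrix (Fin N) (Fin N) ℂ) := by rw [← smul_smul, hc]

/-- From the group commutator `B A B⁻¹ A⁻¹ = ω^k·1` to the matrix Weyl relation `A B = conj(ω^k) · B A`. [folklore] -/
theorem coe_mul_eq_smul_of_commutator_eq {k : ZMod N} {A B : Matrix.specialUnitaryGroup (Fin N) ℂ}
    (hAB : B * A * B⁻¹ * A⁻¹ = (suCenter N k : Matrix.specialUnitaryGroup (Fin N) ℂ)) :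
    (A : Matrix (Fin N) (Fin N) ℂ) * B = star (centerPhase N k) • ((B : Matrix (Fin N) (Fin N) ℂ) * A) := by
  have h1 : B * A = (suCenter N k : Matrix.specialUnitaryGroup (Fin N) ℂ) * (A * B) := by rw [← hAB]; group
  have h2 := congrArg (fun g : Matrix.specialUnitaryGroup (Fin N) ℂ => (g : Matrix (Fin N) (Fin N) ℂ)) h1
  simp only [Submonoid.coe_mul, coe_suCenter, Matrix.smul_mul, Matrix.one_mul] at h2
  rw [h2, smul_smul, star_centerPhase_mul_self, one_smul]

/-- `conj(ω^k)` is a primitive `N`-th root of unity when `k` is a unit. [folklore] -/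
theorem isPrimitiveRoot_star_centerPhase [NeZero N] {k : ZMod N} (hk : IsUnit k) : IsPrimitiveRoot (star (centerPhase N k)) N := by
  have h : star (centerPhase N k) = (centerPhase N k)⁻¹ := eq_inv_of_mul_eq_one_left (star_centerPhase_mul_self k)
  rw [h]
  exact (isPrimitiveRoot_centerPhase N hk).inv

/-- ★ **Value at the vacuum**: along any line through a decorated twist-eating ladder the twisted action vanishes at `t = 0` (K2).
[cite: Gonzalezarroyo1998, §4.2] -/
theorem twistedAction_along_zero {k : ZMod N} {A B : Matrix.specialUnitaryGroup (Fin N) ℂ}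
    (hAB : B * A * B⁻¹ * A⁻¹ = (suCenter N k : Matrix.specialUnitaryGroup (Fin N) ℂ)) (i j : ZMod N)
    (a : Fin 4 → FinTorusSite (m + 1) (m + 1) (m₂ + 1) (m₃ + 1) → Matrix (Fin N) (Fin N) ℂ) :
    lineAction (ladderField ![(A : Matrix (Fin N) (Fin N) ℂ), (B : Matrix (Fin N) (Fin N) ℂ), centerPhase N i • (1 : Matrix (Fin N) (Fin N) ℂ),
        centerPhase N j • (1 : Matrix (Fin N) (Fin N) ℂ)]) a (slabTwistPhase k) 0 = 0 :=
  lineAction_zero (star_slabTwistPhase_mul_self k) (fun x μ ν hμν => ladder_eats_slabTwistPhase hAB i j x μ ν hμν)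

/-- ★ **Criticality**: along any skew-Hermitian line through a decorated twist-eating ladder the first variation vanishes.
[cite: GarciaperezGonzalezarroyoOkawa2017, §2.2–2.3] -/
theorem deriv_twistedAction_along_zero {k : ZMod N} {A B : Matrix.specialUnitaryGroup (Fin N) ℂ}
    (hAB : B * A * B⁻¹ * A⁻¹ = (suCenter N k : Matrix.specialUnitaryGroup (Fin N) ℂ)) (i j : ZMod N)
    {a : Fin 4 → FinTorusSite (m + 1) (m + 1) (m₂ + 1) (m₃ + 1) → Matrix (Fin N) (Fin N) ℂ} (hskew : ∀ μ x, (a μ x)ᴴ = -a μ x) :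
    deriv (lineAction (ladderField ![(A : Matrix (Fin N) (Fin N) ℂ), (B : Matrix (Fin N) (Fin N) ℂ),
        centerPhase N i • (1 : Matrix (Fin N) (Fin N) ℂ), centerPhase N j • (1 : Matrix (Fin N) (Fin N) ℂ)]) a (slabTwistPhase k)) 0 = 0 :=
  deriv_lineAction_zero
    (ladderField_pair_mem_unitaryGroup (Matrix.specialUnitaryGroup_le_unitaryGroup A.2) (Matrix.specialUnitaryGroup_le_unitaryGroup B.2)
      (star_centerPhase_mul_self i) (star_centerPhase_mul_self j))
    (star_slabTwistPhase_mul_self k) (fun x μ ν hμν => ladder_eats_slabTwistPhase hAB i j x μ ν hμν) hskew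

/-- ★★★ **K3 — TRANSVERSAL NON-DEGENERACY OF THE CLASSICAL VACUA OF THE e₂-PROJECTED SLAB WEIGHT, IN T1's CURRENCY.**  `SU(N)`, `k` a unit
(generating twist), reference pair `B A B⁻¹ A⁻¹ = ω^k·1`, centre labels `i, j`, ANY box `(m+1) × (m+1) × (m₂+1) × (m₃+1)`.  For every family
of `SU(N)` configurations `V t` with `↑(V t (x,μ)) = e^{t a_μ(x)} · ↑(ladderConfig ![A, B, ω^i·1, ω^j·1] (x,μ))` and every traceless
skew-Hermitian lattice 1-form `a` on the Coulomb slice of the ladder (`div a = 0`):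
`4 sin²(π/(N(m+1))) · Σ_x Σ_μ S(a_μ x) ≤ d²/dt²|₀ Σ_x Σ_{μ<ν} (N − Re tr ρ_fund(w_x · P_{V t}(x)))`,
the integrand exponent of `wilsonFinTorusTensorTwistedPartition (fundamentalRep (Fin N)) β (slabTwist (ω^k·1) 1)` (the `z^{k′} = 1` summands of
`projSlabZ`).  The constant is the square of the smallest twisted momentum and does NOT depend on the long extents `m₂ + 1 = L`, `m₃ + 1 = T`.
[cite: GarciaperezGonzalezarroyoOkawa2017, §2.2 («the irreducibility condition eliminates the presence of zero-modes»), §2.3, §2.5]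
[cite: GarciaperezGonzalezarroyoOkawa2014, §3] -/
theorem twistedAction_hessian_gap_ladder_specialUnitary [NeZero N] {k : ZMod N} (hk : IsUnit k) {A B : Matrix.specialUnitaryGroup (Fin N) ℂ}
    (hAB : B * A * B⁻¹ * A⁻¹ = (suCenter N k : Matrix.specialUnitaryGroup (Fin N) ℂ)) (i j : ZMod N)
    {a : Fin 4 → FinTorusSite (m + 1) (m + 1) (m₂ + 1) (m₃ + 1) → Matrix (Fin N) (Fin N) ℂ}
    (hskew : ∀ μ x, (a μ x)ᴴ = -a μ x) (htr : ∀ μ x, (a μ x).trace = 0)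
    (hdiv : ∀ x, covDiv (fun e => ((ladderConfig ![A, B, (suCenter N i : Matrix.specialUnitaryGroup (Fin N) ℂ),
        (suCenter N j : Matrix.specialUnitaryGroup (Fin N) ℂ)] e : Matrix.specialUnitaryGroup (Fin N) ℂ) : Matrix (Fin N) (Fin N) ℂ)) a x = 0)
    (V : ℝ → FinTorusSite (m + 1) (m + 1) (m₂ + 1) (m₃ + 1) × Fin 4 → Matrix.specialUnitaryGroup (Fin N) ℂ)
    (hV : ∀ (t : ℝ) (x : FinTorusSite (m + 1) (m + 1) (m₂ + 1) (m₃ + 1)) (μ : Fin 4),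
      ((V t (x, μ) : Matrix.specialUnitaryGroup (Fin N) ℂ) : Matrix (Fin N) (Fin N) ℂ) =
        exp (t • a μ x) * ((ladderConfig ![A, B, (suCenter N i : Matrix.specialUnitaryGroup (Fin N) ℂ),
          (suCenter N j : Matrix.specialUnitaryGroup (Fin N) ℂ)] (x, μ) : Matrix.specialUnitaryGroup (Fin N) ℂ) : Matrix (Fin N) (Fin N) ℂ)) :
    4 * Real.sin (Real.pi / ((N : ℝ) * (m + 1 : ℕ))) ^ 2 * ∑ x, ∑ μ, (((a μ x)ᴴ * a μ x).trace).re ≤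
      iteratedDeriv 2 (fun t => ∑ x : FinTorusSite (m + 1) (m + 1) (m₂ + 1) (m₃ + 1), ∑ q : {q : Fin 4 × Fin 4 // q.1 < q.2},
        ((N : ℝ) - (fundamentalRep (Fin N) (tHooftTwistTensor (slabTwist (suCenter N k : Matrix.specialUnitaryGroup (Fin N) ℂ) 1)
          x q.1.1 q.1.2 * finTorusPlaquette (V t) x q.1.1 q.1.2)).trace.re)) 0 := by
  have hfun : (fun t => ∑ x : FinTorusSite (m + 1) (m + 1) (m₂ + 1) (m₃ + 1), ∑ q : {q : Fin 4 × Fin 4 // q.1 < q.2},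
        ((N : ℝ) - (fundamentalRep (Fin N) (tHooftTwistTensor (slabTwist (suCenter N k : Matrix.specialUnitaryGroup (Fin N) ℂ) 1)
          x q.1.1 q.1.2 * finTorusPlaquette (V t) x q.1.1 q.1.2)).trace.re)) =
      lineAction (ladderField ![(A : Matrix (Fin N) (Fin N) ℂ), (B : Matrix (Fin N) (Fin N) ℂ),
        centerPhase N i • (1 : Matrix (Fin N) (Fin N) ℂ), centerPhase N j • (1 : Matrix (Fin N) (Fin N) ℂ)]) a (slabTwistPhase k) := by
    funext t
    rw [twistedAction_along_eq_lineAction k _ a V hV t, coe_ladderConfig_pair]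
  have hdiv' : ∀ x, covDiv (ladderField ![(A : Matrix (Fin N) (Fin N) ℂ), (B : Matrix (Fin N) (Fin N) ℂ),
      centerPhase N i • (1 : Matrix (Fin N) (Fin N) ℂ), centerPhase N j • (1 : Matrix (Fin N) (Fin N) ℂ)]) a x = 0 := by
    rw [← coe_ladderConfig_pair]; exact hdiv
  rw [hfun]
  exact ladder_hessian_gap (Matrix.specialUnitaryGroup_le_unitaryGroup A.2) (Matrix.specialUnitaryGroup_le_unitaryGroup B.2)
    (isPrimitiveRoot_star_centerPhase hk) (coe_mul_eq_smul_of_commutator_eq hAB) (star_centerPhase_mul_self i)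
    (star_centerPhase_mul_self j) (star_slabTwistPhase_mul_self k) (fun x μ ν hμν => ladder_eats_slabTwistPhase hAB i j x μ ν hμν)
    hskew htr hdiv'

end LadderSU

end Summit.QuantumFields.YangMills.Cruxes.IRcof.TwistedSlab

end
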